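import Literature.Analysis.FluidPDE.Seregin2020AxisymmetricTypeII
import Literature.Analysis.FluidPDE.CKNLocalEnergyBound
import Literature.Analysis.FluidPDE.CKNInnerCylinders
import Literature.Analysis.FluidPDE.PressureDecayEstimateProofs
import Literature.Analysis.FluidPDE.RusinSverakBackwardRegularity
import HarnessLib

/-!
# Seregin 2020, the step "`g(z₀) < ∞ ⇒ G(z₀) < ∞`" of the proof of Theorem 2.1: the case of a
# bounded cubic quantity `C`, at cylinders touching the top of the domain

Analysis/FluidPDE proof file (everything proved; no definitions, no named facts) on the way to
the discharge of the named fact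
`Literature.Analysis.FluidPDE.Seregin2020_axisymmetricSingularPoint_typeII`
(`Seregin2020AxisymmetricTypeII.lean`; G. Seregin, *Local regularity of axisymmetric solutions
to the Navier–Stokes equations*, Anal. Math. Phys. 10 (2020), Paper 46 = arXiv:2006.04140,
Thm. 2.1).

The printed proof of Theorem 2.1 argues by contradiction from a Type I blow-up at the origin,
`g(0) = min{limsup E, limsup A, limsup C} < ∞` (Def. 1.7), and its first step is the remark
following Def. 1.7 (arXiv p. 4): "It is useful to notice that if `g(z₀) < ∞`, see [Seregin2006],
then `G(z₀) = max{limsup E, limsup A, limsup C, limsup D₀} < ∞` … `D₀` can be replaced with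
`D`", which the proof then uses in the form (2.7),
`L₀ = sup_{0<r<1} A(r) + sup C(r) + sup E(r) + sup D(r) < ∞`. The cited source (G. Seregin,
*Estimates of suitable weak solutions to the Navier–Stokes equations in critical Morrey
spaces*, Zap. Nauchn. Sem. POMI 336 (2006) = J. Math. Sci. 143 (2007)) derives this from the
standard estimates between the scaled quantities `A, E, C, D` of a suitable weak solution — the
local energy inequality, the decay estimate for the pressure and the multiplicative
inequality — iterated along the scales `θᵏ r₀`.

This file proves the case **`limsup_{r→0} C(z₀, r) < ∞`** of that step, in the accepted
vocabulary (`cknAEss`, `cknE`, `cknC`, `cknD` on the backward parabolic balls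
`Q_r(z₀) = ]t₀ - r², t₀[ × B(x₀, r)`, `SuitableWeak.lean` / `LocalTypeI.lean`), from two
estimates already PROVED in the tree:

* the decay estimate for the pressure `D(θr) ≤ c (θ D(r) + θ⁻² C(r))`
  (`seregin_sverak_pressure_decay_holds`, `PressureDecayEstimateProofs.lean`; Seregin–Šverák
  2009 (as13)), iterated along `θʲ r₀` (`cknD_iterate_le_of_pressure_decay`,
  `RusinSverakBackwardRegularity.lean`), and
* the local energy bound `A(θR) + E(θR) ≤ c₁θ²C(R)^{2/3} + c₂θ⁻²C(R) + c₃θ⁻²D(R)^{2/3}C(R)^{1/3}`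
  (`localEnergyBound`, `CKNLocalEnergyBound.lean`; Lemarié-Rieusset 2016, p. 506).

The one point needing care is that the singular point of Theorem 2.1 sits at the TOP of the
domain `Q = 𝒞 × ]-1, 0[`: the cylinders `Q_r(0)` have `Q_r(0) ⊆ Q` but not
`closure Q_r(0) ⊆ Q`, whereas `localEnergyBound` is stated for cylinders with closure inside the
domain. The passage to cylinders touching the top ("the proof … assumes the information only at
times previous to `t`", Tsai 1998, p. 46) is the inner approximation prepared in
`CKNInnerCylinders.lean`: the bound is applied on the inner cylinders `Q_{σₙR}(t - δₙ, x)`,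
`σₙ ↑ 1`, whose data `C, D` are at most `4` times those of `Q_R(t, x)` (`σₙ ≥ 1/2`), and
`A(R/2), E(R/2)` at the top are recovered as suprema over the exhausting windows
(`cknAEss_le_iSup_window`, `iSup_window_lintegral`).

## Contents (all in `namespace Literature.Analysis.FluidPDE.Seregin2020`)

* `exists_bound_of_limsup_lt_top` — `limsup_{r→0+} f < ∞` gives a bound `f ≤ M` on some
  `]0, r₀]`;
* `cknC_le_mul_of_subset`, `exists_innerScales_half` — bookkeeping;
* `localEnergyBound_top` — the local energy bound for cylinders `Q_R(z) ⊆ Q` touching the top: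
  `A(R/2) + E(R/2) ≤ c₁ C(R)^{2/3} + c₂ C(R) + c₃ D(R)^{2/3} C(R)^{1/3}` (unforced, `ν = 1`);
* `scaledEnergies_bounded_of_cknC_le` — **the case `C` of Seregin's remark**: if `(u, p)` is a
  suitable weak solution on `Q ⊇ Q_{r₀}(z)` with `D(r₀; z) < ∞` and `C(r; z) ≤ M` for
  `0 < r ≤ r₀`, then `A + E + C + D ≤ K` on `]0, r₀/2]` for some `K < ∞`;
* `scaledEnergies_bounded_of_limsup_cknC_lt_top` — the same from `limsup_{r→0} C(z, r) < ∞`.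

The cases `limsup A < ∞` and `limsup E < ∞` of the remark (which need the multiplicative
inequality in the finer forms (6.1.34)–(6.1.38) of Seregin's 2014 lecture notes) are NOT in this
file.

## References

* G. Seregin, Anal. Math. Phys. 10 (2020), Paper 46 = arXiv:2006.04140: Def. 1.7 and the remark
  following it, (2.7). [`Seregin2020`]
* G. Seregin, V. Šverák, Comm. PDE 34 (2009), proof of Lemma 3.5, (as13). [`SereginSverak2009`]
* P. G. Lemarié-Rieusset, *The Navier–Stokes Problem in the 21st Century* (2016), proof of
  Thm. 14.4, p. 506. [`Lemarierieusset2023`]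
* T.-P. Tsai, Arch. Rational Mech. Anal. 143 (1998), remark after Lemma 4.2 (p. 46). [`Tsai1998`]
* G. Seregin, *Lecture Notes on Regularity Theory for the Navier–Stokes Equations* (2014),
  Lemmas 6.2–6.4. [`Seregin2014`]
-/

noncomputable section

open MeasureTheory Set Function Filter Topology TopologicalSpace Metric
open scoped NNReal ENNReal

namespace Literature.Analysis.FluidPDE

namespace Seregin2020

/-! ### Elementary tools -/

/-- A function with `limsup_{r → 0+} f(r) < ∞` in `ℝ≥0∞` is bounded by a finite constant on some
interval `]0, r₀]` (the form in which "`limsup_{r→0} C(z₀, r) < ∞`" is consumed). [folklore] -/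
theorem exists_bound_of_limsup_lt_top {f : ℝ → ℝ≥0∞} (hf : limsup f (𝓝[>] (0 : ℝ)) < ∞) :
    ∃ M : ℝ≥0, ∃ r₀ : ℝ, 0 < r₀ ∧ ∀ r ∈ Ioc (0 : ℝ) r₀, f r ≤ M := by
  obtain ⟨M, hM⟩ : ∃ M : ℝ≥0, limsup f (𝓝[>] (0 : ℝ)) < M := by
    obtain ⟨m, hm⟩ := ENNReal.lt_iff_exists_coe.1 hf
    exact ⟨m + 1, by rw [hm.1]; exact_mod_cast lt_add_one m⟩
  have hev : ∀ᶠ r in 𝓝[>] (0 : ℝ), f r < M := eventually_lt_of_limsup_lt hM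
  rw [(nhdsGT_basis (0 : ℝ)).eventually_iff] at hev
  obtain ⟨ε, hε, h⟩ := hev
  refine ⟨M, ε / 2, half_pos hε, fun r hr => (h ?_).le⟩
  rw [mem_Ioo]
  exact ⟨hr.1, by linarith [hr.2]⟩

/-- Scaled cubic quantity under inclusion: `C(r'; z') ≤ (r/r')² C(r; z)` if
`Q_{r'}(z') ⊆ Q_r(z)` (companion of `cknD_le_mul_of_subset`). [folklore] -/
theorem cknC_le_mul_of_subset {r r' : ℝ} {z z' : ℝ × EuclideanSpace ℝ (Fin 3)} (hr : 0 < r) (hr' : 0 < r')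
    (h : parabolicCylinder r' z' ⊆ parabolicCylinder r z) (u : ℝ → EuclideanSpace ℝ (Fin 3) → EuclideanSpace ℝ (Fin 3)) :
    cknC r' z' u ≤ ENNReal.ofReal (r / r') ^ 2 * cknC r z u := by
  have e : (ENNReal.ofReal r' ^ 2)⁻¹ =
      ENNReal.ofReal (r / r') ^ 2 * (ENNReal.ofReal r ^ 2)⁻¹ := by
    rw [ENNReal.inv_pow, ENNReal.inv_ofReal_eq_mul hr hr', mul_pow, ← ENNReal.inv_pow]
  rw [cknC, cknC, e, mul_assoc]
  exact mul_le_mul_right (mul_le_mul_right (lintegral_mono_set h) _) _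

/-- Inner scales `σₙ ∈ [1/2, 1[` increasing to `1` (`σₙ = 1 - 1/(n+2)`), as in
`exists_innerScales`, with the lower bound `σₙ ≥ 1/2` recorded. [folklore] -/
theorem exists_innerScales_half :
    ∃ σ : ℕ → ℝ, (∀ n, 1 / 2 ≤ σ n) ∧ (∀ n, 0 < σ n) ∧ (∀ n, σ n < 1) ∧ Monotone σ ∧
      Tendsto σ atTop (𝓝 1) := by
  refine ⟨fun n => 1 - 1 / ((n : ℝ) + 2), fun n => ?_, fun n => ?_, fun n => ?_,
    fun m n hmn => ?_, ?_⟩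
  · have : (1 : ℝ) / ((n : ℝ) + 2) ≤ 1 / 2 :=
      one_div_le_one_div_of_le (by norm_num) (by linarith [n.cast_nonneg (α := ℝ)])
    dsimp only
    linarith
  · have : (1 : ℝ) / ((n : ℝ) + 2) < 1 := by
      rw [div_lt_one (by positivity)]
      linarith [n.cast_nonneg (α := ℝ)]
    dsimp only
    linarith
  · have : (0 : ℝ) < 1 / ((n : ℝ) + 2) := by positivity
    dsimp only
    linarith
  · have : (1 : ℝ) / ((n : ℝ) + 2) ≤ 1 / ((m : ℝ) + 2) :=
      one_div_le_one_div_of_le (by positivity) (by exact_mod_cast Nat.add_le_add_right hmn 2)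
    dsimp only
    linarith
  · have h : Tendsto (fun n : ℕ => 1 - 1 / ((n : ℝ) + 2)) atTop (𝓝 (1 - 0)) := by
      refine tendsto_const_nhds.sub ?_
      have h1 := tendsto_one_div_add_atTop_nhds_zero_nat (𝕜 := ℝ)
      have h2 : Tendsto (fun n : ℕ => n + 1) atTop atTop := tendsto_add_atTop_nat 1
      convert h1.comp h2 using 2 with n
      simp only [comp_apply, Nat.cast_add, Nat.cast_one]
      ring
    rwa [sub_zero] at h

/-- `(4x)^e ≤ 4 x^e` in `ℝ≥0∞` for `0 ≤ e ≤ 1`. [folklore] -/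
theorem rpow_four_mul_le (x : ℝ≥0∞) {e : ℝ} (he0 : 0 ≤ e) (he1 : e ≤ 1) :
    (4 * x) ^ e ≤ 4 * x ^ e := by
  rw [ENNReal.mul_rpow_of_nonneg _ _ he0]
  gcongr
  calc (4 : ℝ≥0∞) ^ e ≤ 4 ^ (1 : ℝ) :=
        ENNReal.rpow_le_rpow_of_exponent_le (by norm_num) he1
    _ = 4 := ENNReal.rpow_one _

/-! ### The local energy bound at cylinders touching the top of the domain -/

/-- **Local energy bound for cylinders `Q_R(z) ⊆ Q` (possibly touching the top of `Q`).**
There are constants `c₁, c₂, c₃` such that for every suitable weak solution `(u, p)` of the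
unforced Navier–Stokes equations (`ν = 1`) on an open `Q ⊆ ℝ × EuclideanSpace ℝ (Fin 3)`, every weak spatial gradient
`G` of `u` on `Q` and every backward cylinder with `Q_R(z) ⊆ Q`,
`A(R/2; z) + E(R/2; z) ≤ c₁ C(R; z)^{2/3} + c₂ C(R; z) + c₃ D(R; z)^{2/3} C(R; z)^{1/3}`
(`A = cknAEss`, `E = cknE`, `C = cknC`, `D = cknD`). From `localEnergyBound`
(Lemarié-Rieusset 2016, p. 506) on the inner cylinders of `CKNInnerCylinders.lean` and the
exhaustion of `Q_{R/2}(z)` by windows (Tsai 1998, remark after Lemma 4.2).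
[cite: Tsai1998, remark after Lemma 4.2 (p. 46); Lemarierieusset2023 §14.3 p. 506] -/
theorem localEnergyBound_top :
    ∃ c₁ c₂ c₃ : ℝ≥0, ∀ (Q : Opens (ℝ × EuclideanSpace ℝ (Fin 3))) (u : ℝ → EuclideanSpace ℝ (Fin 3) → EuclideanSpace ℝ (Fin 3)) (p : ℝ → EuclideanSpace ℝ (Fin 3) → ℝ)
      (G : ℝ → EuclideanSpace ℝ (Fin 3) → EuclideanSpace ℝ (Fin 3) →L[ℝ] EuclideanSpace ℝ (Fin 3)), IsSuitableWeakSolutionOn Q 1 0 u p →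
      HasWeakSpatialGradientOn Q u G →
      ∀ (z : ℝ × EuclideanSpace ℝ (Fin 3)) (R : ℝ), 0 < R → parabolicCylinder R z ⊆ (Q : Set (ℝ × EuclideanSpace ℝ (Fin 3))) →
        cknAEss (R / 2) z u + cknE (R / 2) z G ≤
          c₁ * cknC R z u ^ (2 / 3 : ℝ) + c₂ * cknC R z u +
            c₃ * (cknD R z p ^ (2 / 3 : ℝ) * cknC R z u ^ (1 / 3 : ℝ)) := by
  obtain ⟨c₁, c₂, c₃, c₄, H⟩ := localEnergyBound one_pos
  refine ⟨2 * (c₁ * 4), 2 * (c₂ * 16), 2 * (c₃ * 64), fun Q u p G hsw hG z R hR hQ => ?_⟩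
  obtain ⟨σ, hσh, hσ0, hσ1, hσm, hσt⟩ := exists_innerScales_half
  set C := cknC R z u with hC
  set D := cknD R z p with hD
  set K : ℝ≥0∞ := (c₁ * 4 : ℝ≥0) * C ^ (2 / 3 : ℝ) + (c₂ * 16 : ℝ≥0) * C +
    (c₃ * 64 : ℝ≥0) * (D ^ (2 / 3 : ℝ) * C ^ (1 / 3 : ℝ)) with hK
  have hθ : (0 : ℝ) < 2⁻¹ := by norm_num
  have hθ2 : ((2 : ℝ)⁻¹) ^ 2 ≤ 1 / 2 := by norm_num
  -- ### Step 1: the bound on the inner cylinders, uniformly in `n`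
  have inner : ∀ n : ℕ,
      cknAEss (2⁻¹ * (σ n * R)) (z.1 - (R ^ 2 - (σ n * R) ^ 2) / 2, z.2) u +
        cknE (2⁻¹ * (σ n * R)) (z.1 - (R ^ 2 - (σ n * R) ^ 2) / 2, z.2) G ≤ K := by
    intro n
    set r' := σ n * R with hr'
    set z' : ℝ × EuclideanSpace ℝ (Fin 3) := (z.1 - (R ^ 2 - r' ^ 2) / 2, z.2) with hz'
    have hr'0 : 0 < r' := mul_pos (hσ0 n) hR
    have hr'R : r' < R := by
      have := hσ1 n
      have : σ n * R < 1 * R := mul_lt_mul_of_pos_right this hR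
      simpa [hr'] using this
    have hcl : closure (parabolicCylinder r' z') ⊆ (Q : Set (ℝ × EuclideanSpace ℝ (Fin 3))) :=
      (closure_parabolicCylinder_inner_subset hr'0 hr'R z).trans hQ
    have hsub : parabolicCylinder r' z' ⊆ parabolicCylinder R z :=
      parabolicCylinder_inner_subset hr'0 hr'R z
    have hf0 : MemLp (uncurry (0 : ℝ → EuclideanSpace ℝ (Fin 3) → EuclideanSpace ℝ (Fin 3))) (ENNReal.ofReal (3 / 2))
        (volume.restrict (Q : Set (ℝ × EuclideanSpace ℝ (Fin 3)))) := MemLp.zero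
    have key := H Q (3 / 2) 0 u p G hsw le_rfl hf0 hG z' r' 2⁻¹ hr'0 hθ (by norm_num) hcl
    -- the data of the inner cylinder
    have hratio : ENNReal.ofReal (R / r') ^ 2 ≤ 4 := by
      have h1 : R / r' ≤ 2 := by
        rw [div_le_iff₀ hr'0, hr']
        have := hσh n
        nlinarith
      calc ENNReal.ofReal (R / r') ^ 2 ≤ ENNReal.ofReal 2 ^ 2 := by
            gcongr
        _ = 4 := by rw [ENNReal.ofReal_ofNat]; norm_num
    have hC' : cknC r' z' u ≤ 4 * C :=
      (cknC_le_mul_of_subset hR hr'0 hsub u).trans (mul_le_mul_left hratio _)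
    have hD' : cknD r' z' p ≤ 4 * D :=
      (cknD_le_mul_of_subset hR hr'0 hsub p).trans (mul_le_mul_left hratio _)
    have hF : cknF (3 / 2) r' z' (0 : ℝ → EuclideanSpace ℝ (Fin 3) → EuclideanSpace ℝ (Fin 3)) = 0 := by
      simp [cknF, ENNReal.zero_rpow_of_pos (show (0 : ℝ) < 3 / 2 by norm_num)]
    have e4 : ENNReal.ofReal (((2 : ℝ)⁻¹ ^ 2)⁻¹) = 4 := by norm_num
    have e1 : ENNReal.ofReal ((2 : ℝ)⁻¹ ^ 2) ≤ 1 := by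
      rw [← ENNReal.ofReal_one]; exact ENNReal.ofReal_le_ofReal (by norm_num)
    refine key.trans ?_
    rw [hF, ENNReal.zero_rpow_of_pos (by norm_num), mul_zero, zero_mul, add_zero, e4]
    -- term by term
    have t1 : (c₁ : ℝ≥0∞) * ENNReal.ofReal ((2 : ℝ)⁻¹ ^ 2) * cknC r' z' u ^ (2 / 3 : ℝ) ≤
        (c₁ * 4 : ℝ≥0) * C ^ (2 / 3 : ℝ) := by
      calc (c₁ : ℝ≥0∞) * ENNReal.ofReal ((2 : ℝ)⁻¹ ^ 2) * cknC r' z' u ^ (2 / 3 : ℝ)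
          ≤ c₁ * 1 * (4 * C) ^ (2 / 3 : ℝ) := by gcongr
        _ ≤ c₁ * 1 * (4 * C ^ (2 / 3 : ℝ)) := by
            gcongr; exact rpow_four_mul_le C (by norm_num) (by norm_num)
        _ = (c₁ * 4 : ℝ≥0) * C ^ (2 / 3 : ℝ) := by push_cast; ring
    have t2 : (c₂ : ℝ≥0∞) * 4 * cknC r' z' u ≤ (c₂ * 16 : ℝ≥0) * C := by
      calc (c₂ : ℝ≥0∞) * 4 * cknC r' z' u ≤ c₂ * 4 * (4 * C) := by gcongr
        _ = (c₂ * 16 : ℝ≥0) * C := by push_cast; ring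
    have t3 : (c₃ : ℝ≥0∞) * 4 * cknD r' z' p ^ (2 / 3 : ℝ) * cknC r' z' u ^ (1 / 3 : ℝ) ≤
        (c₃ * 64 : ℝ≥0) * (D ^ (2 / 3 : ℝ) * C ^ (1 / 3 : ℝ)) := by
      calc (c₃ : ℝ≥0∞) * 4 * cknD r' z' p ^ (2 / 3 : ℝ) * cknC r' z' u ^ (1 / 3 : ℝ)
          ≤ c₃ * 4 * (4 * D) ^ (2 / 3 : ℝ) * (4 * C) ^ (1 / 3 : ℝ) := by gcongr
        _ ≤ c₃ * 4 * (4 * D ^ (2 / 3 : ℝ)) * (4 * C ^ (1 / 3 : ℝ)) := by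
            gcongr
            · exact rpow_four_mul_le D (by norm_num) (by norm_num)
            · exact rpow_four_mul_le C (by norm_num) (by norm_num)
        _ = (c₃ * 64 : ℝ≥0) * (D ^ (2 / 3 : ℝ) * C ^ (1 / 3 : ℝ)) := by push_cast; ring
    calc _ ≤ _ := add_le_add (add_le_add t1 t2) t3
      _ = K := by rw [hK]
  -- ### Step 2: the dissipation at the top by exhaustion
  have hE : cknE (2⁻¹ * R) z G ≤ K := by
    rw [cknE, ← iSup_window_lintegral hσ0 hσ1 hσm hσt hR hθ z volume
      (fun w => ENNReal.ofReal (frobeniusNormSq (G w.1 w.2))), ENNReal.mul_iSup]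
    refine iSup_le fun n => ?_
    have hV := window_subset_parabolicCylinder_inner hθ2 (le_of_lt ?hlt) (mul_pos (hσ0 n) hR).le z
      (r := R) (r' := σ n * R)
    case hlt =>
      have := hσ1 n
      have : σ n * R < 1 * R := mul_lt_mul_of_pos_right this hR
      simpa using this
    refine (window_lintegral_le_cknE hθ (le_of_lt ?_) hV G).trans (le_add_self.trans (inner n))
    have := hσ1 n
    have : σ n * R < 1 * R := mul_lt_mul_of_pos_right this hR
    simpa using this
  -- ### Step 3: the energy at the top by exhaustion
  have hA : cknAEss (2⁻¹ * R) z u ≤ K := by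
    refine (cknAEss_le_iSup_window hσ1 hσm hσt hR hθ z u).trans (iSup_le fun n => ?_)
    have hle : σ n * R ≤ R := by
      have := hσ1 n
      have : σ n * R < 1 * R := mul_lt_mul_of_pos_right this hR
      exact le_of_lt (by simpa using this)
    have hI := Ioo_window_subset hθ2 hle (mul_pos (hσ0 n) hR).le z.1 (θ := 2⁻¹)
    exact (window_essSup_le_cknAEss hθ hle hI u).trans (le_self_add.trans (inner n))
  -- ### Conclusion
  have h2 : R / 2 = 2⁻¹ * R := by ring
  rw [h2]
  calc cknAEss (2⁻¹ * R) z u + cknE (2⁻¹ * R) z G ≤ K + K := add_le_add hA hE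
    _ = _ := by rw [hK]; push_cast; ring

/-! ### Bounded `C` forces bounded `A`, `E`, `D` (Seregin 2020, remark after Def. 1.7, case `C`) -/

/-- **Seregin 2020, remark after Def. 1.7 (after Seregin 2006), the case of a bounded cubic
quantity.** Let `(u, p)` be a suitable weak solution of the unforced Navier–Stokes equations
(`ν = 1`) on an open `Q ⊆ ℝ × EuclideanSpace ℝ (Fin 3)`, `G` a weak spatial gradient of `u` on `Q`, and `Q_{r₀}(z) ⊆ Q`
a backward cylinder (possibly touching the top of `Q`) with `D(r₀; z) < ∞`. If
`C(r; z) ≤ M` for all `0 < r ≤ r₀`, then there is `K < ∞` with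
`A(r; z) + E(r; z) + C(r; z) + D(r; z) ≤ K` for all `0 < r ≤ r₀/2`
(`A = cknAEss`, `E = cknE`, `C = cknC`, `D = cknD`). Proof as in Seregin 2006 / Seregin–Šverák
2009, p. 10: the pressure decay estimate iterated along `θʲ r₀` bounds `D`, then the local
energy bound gives `A + E`. [cite: Seregin2020, remark after Def. 1.7 and (2.7)] -/
theorem scaledEnergies_bounded_of_cknC_le {Q : Opens (ℝ × EuclideanSpace ℝ (Fin 3))} {u : ℝ → EuclideanSpace ℝ (Fin 3) → EuclideanSpace ℝ (Fin 3)}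
    {p : ℝ → EuclideanSpace ℝ (Fin 3) → ℝ} {G : ℝ → EuclideanSpace ℝ (Fin 3) → EuclideanSpace ℝ (Fin 3) →L[ℝ] EuclideanSpace ℝ (Fin 3)} (hsw : IsSuitableWeakSolutionOn Q 1 0 u p)
    (hG : HasWeakSpatialGradientOn Q u G) {z : ℝ × EuclideanSpace ℝ (Fin 3)} {r₀ : ℝ} (hr₀ : 0 < r₀)
    (hQ : parabolicCylinder r₀ z ⊆ (Q : Set (ℝ × EuclideanSpace ℝ (Fin 3)))) (hD₀ : cknD r₀ z p ≠ ∞) {M : ℝ≥0}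
    (hM : ∀ r ∈ Ioc (0 : ℝ) r₀, cknC r z u ≤ M) :
    ∃ K : ℝ≥0, ∀ r ∈ Ioc (0 : ℝ) (r₀ / 2),
      cknAEss r z u + cknE r z G + cknC r z u + cknD r z p ≤ K := by
  -- the pressure decay estimate and a ratio `θ` absorbing its constant
  obtain ⟨c, hc⟩ := seregin_sverak_pressure_decay_holds.ratio
  obtain ⟨θ, hθ, hθhalf, hcθ⟩ := exists_ratio_mul_le_half c
  have hθ1 : θ ≤ 1 := hθhalf.trans (by norm_num)
  -- ### Step 1: `D` along the scales `θᴶ r₀`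
  set B : ℝ≥0∞ := cknD r₀ z p + 2 * (c * ENNReal.ofReal ((θ⁻¹) ^ 2) * M) with hB
  have hBtop : B ≠ ∞ := by
    refine ENNReal.add_ne_top.2 ⟨hD₀, ENNReal.mul_ne_top ENNReal.ofNat_ne_top ?_⟩
    exact ENNReal.mul_ne_top (ENNReal.mul_ne_top ENNReal.coe_ne_top ENNReal.ofReal_ne_top)
      ENNReal.coe_ne_top
  have hDJ : ∀ J : ℕ, cknD (θ ^ J * r₀) z p ≤ B := by
    intro J
    have hCj : ∀ j < J, cknC (θ ^ j * r₀) z u ≤ M := fun j _ =>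
      hM _ ⟨by positivity, mul_le_of_le_one_left hr₀.le (pow_le_one₀ hθ.le hθ1)⟩
    refine (cknD_iterate_le_of_pressure_decay hc hθ hθ1 hcθ hsw.distributional hr₀ hQ
      hCj).trans ?_
    rw [hB]
    gcongr
    calc (2⁻¹ : ℝ≥0∞) ^ J * cknD r₀ z p ≤ 1 * cknD r₀ z p := by
          gcongr
          exact pow_le_one₀ zero_le (ENNReal.inv_le_one.2 one_le_two)
      _ = cknD r₀ z p := one_mul _
  -- ### Step 2: `D` at every scale `0 < r ≤ r₀`
  have hDr : ∀ r ∈ Ioc (0 : ℝ) r₀, cknD r z p ≤ ENNReal.ofReal (θ⁻¹) ^ 2 * B := by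
    intro r hr
    obtain ⟨J, hJ1, hJ2⟩ := exists_nat_pow_near_of_lt_one (div_pos hr.1 hr₀)
      ((div_le_one hr₀).2 hr.2) hθ (by linarith)
    have hle : r ≤ θ ^ J * r₀ := by rwa [div_le_iff₀ hr₀] at hJ2
    have hlt : θ ^ J * r₀ < θ⁻¹ * r := by
      rw [lt_div_iff₀ hr₀] at hJ1
      have : θ ^ J * r₀ = θ⁻¹ * (θ ^ (J + 1) * r₀) := by
        rw [pow_succ]; field_simp
      rw [this]
      exact mul_lt_mul_of_pos_left hJ1 (inv_pos.2 hθ)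
    have hsub : parabolicCylinder r z ⊆ parabolicCylinder (θ ^ J * r₀) z :=
      parabolicCylinder_mono hr.1.le hle z
    calc cknD r z p ≤ ENNReal.ofReal (θ ^ J * r₀ / r) ^ 2 * cknD (θ ^ J * r₀) z p :=
          cknD_le_mul_of_subset (by positivity) hr.1 hsub p
      _ ≤ ENNReal.ofReal (θ⁻¹) ^ 2 * B := by
          gcongr
          · exact (div_le_iff₀ hr.1).2 hlt.le
          · exact hDJ J
  -- ### Step 3: `A + E` from the local energy bound at the top
  obtain ⟨c₁, c₂, c₃, HT⟩ := localEnergyBound_top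
  set B' : ℝ≥0∞ := ENNReal.ofReal (θ⁻¹) ^ 2 * B with hB'
  have hB'top : B' ≠ ∞ := ENNReal.mul_ne_top (ENNReal.pow_ne_top ENNReal.ofReal_ne_top) hBtop
  set L : ℝ≥0∞ := c₁ * (M : ℝ≥0∞) ^ (2 / 3 : ℝ) + c₂ * M +
    c₃ * (B' ^ (2 / 3 : ℝ) * (M : ℝ≥0∞) ^ (1 / 3 : ℝ)) + M + B' with hL
  have hLtop : L ≠ ∞ := by
    have hM23 : (M : ℝ≥0∞) ^ (2 / 3 : ℝ) ≠ ∞ := ENNReal.rpow_ne_top_of_nonneg (by norm_num)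
      ENNReal.coe_ne_top
    have hM13 : (M : ℝ≥0∞) ^ (1 / 3 : ℝ) ≠ ∞ := ENNReal.rpow_ne_top_of_nonneg (by norm_num)
      ENNReal.coe_ne_top
    have hB23 : B' ^ (2 / 3 : ℝ) ≠ ∞ := ENNReal.rpow_ne_top_of_nonneg (by norm_num) hB'top
    rw [hL]
    refine ENNReal.add_ne_top.2 ⟨ENNReal.add_ne_top.2 ⟨ENNReal.add_ne_top.2
      ⟨ENNReal.add_ne_top.2 ⟨?_, ?_⟩, ?_⟩, ENNReal.coe_ne_top⟩, hB'top⟩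
    · exact ENNReal.mul_ne_top ENNReal.coe_ne_top hM23
    · exact ENNReal.mul_ne_top ENNReal.coe_ne_top ENNReal.coe_ne_top
    · exact ENNReal.mul_ne_top ENNReal.coe_ne_top (ENNReal.mul_ne_top hB23 hM13)
  refine ⟨L.toNNReal, fun r hr => ?_⟩
  rw [ENNReal.coe_toNNReal hLtop]
  have h2r : 2 * r ∈ Ioc (0 : ℝ) r₀ := ⟨by linarith [hr.1], by linarith [hr.2]⟩
  have hrr : r ∈ Ioc (0 : ℝ) r₀ := ⟨hr.1, by linarith [hr.2]⟩
  have hAE := HT Q u p G hsw hG z (2 * r) h2r.1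
    ((parabolicCylinder_mono (by linarith [hr.1]) h2r.2 z).trans hQ)
  rw [show 2 * r / 2 = r by ring] at hAE
  have hC2 : cknC (2 * r) z u ≤ M := hM _ h2r
  have hD2 : cknD (2 * r) z p ≤ B' := hDr _ h2r
  calc cknAEss r z u + cknE r z G + cknC r z u + cknD r z p
      ≤ (c₁ * cknC (2 * r) z u ^ (2 / 3 : ℝ) + c₂ * cknC (2 * r) z u +
          c₃ * (cknD (2 * r) z p ^ (2 / 3 : ℝ) * cknC (2 * r) z u ^ (1 / 3 : ℝ))) +
          M + B' := add_le_add (add_le_add hAE (hM r hrr)) (hDr r hrr)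
    _ ≤ L := by
        rw [hL]
        gcongr

/-- **The case `limsup_{r→0} C(z, r) < ∞` of "`g < ∞ ⇒ G < ∞`"** (Seregin 2020, remark after
Def. 1.7, after Seregin 2006): for a suitable weak solution on `Q ⊇ Q_{r₀}(z)` with `D(r₀; z) < ∞`,
a finite upper limit of the cubic quantity at `z` bounds all four scaled quantities
`A, E, C, D` at `z` on some interval of radii `]0, r₁]`. [cite: Seregin2020, remark after Def. 1.7 and (2.7)] -/
theorem scaledEnergies_bounded_of_limsup_cknC_lt_top {Q : Opens (ℝ × EuclideanSpace ℝ (Fin 3))} {u : ℝ → EuclideanSpace ℝ (Fin 3) → EuclideanSpace ℝ (Fin 3)}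
    {p : ℝ → EuclideanSpace ℝ (Fin 3) → ℝ} {G : ℝ → EuclideanSpace ℝ (Fin 3) → EuclideanSpace ℝ (Fin 3) →L[ℝ] EuclideanSpace ℝ (Fin 3)} (hsw : IsSuitableWeakSolutionOn Q 1 0 u p)
    (hG : HasWeakSpatialGradientOn Q u G) {z : ℝ × EuclideanSpace ℝ (Fin 3)} {r₀ : ℝ} (hr₀ : 0 < r₀)
    (hQ : parabolicCylinder r₀ z ⊆ (Q : Set (ℝ × EuclideanSpace ℝ (Fin 3)))) (hD₀ : cknD r₀ z p ≠ ∞)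
    (hC : limsup (fun r => cknC r z u) (𝓝[>] 0) < ∞) :
    ∃ K : ℝ≥0, ∃ r₁ : ℝ, 0 < r₁ ∧ ∀ r ∈ Ioc (0 : ℝ) r₁,
      cknAEss r z u + cknE r z G + cknC r z u + cknD r z p ≤ K := by
  obtain ⟨M, ρ, hρ, hM⟩ := exists_bound_of_limsup_lt_top hC
  -- shrink to a common radius `r₂ = min ρ r₀`
  set r₂ := min ρ r₀ with hr₂
  have hr₂0 : 0 < r₂ := lt_min hρ hr₀
  have hr₂ρ : r₂ ≤ ρ := min_le_left _ _
  have hr₂r₀ : r₂ ≤ r₀ := min_le_right _ _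
  have hQ₂ : parabolicCylinder r₂ z ⊆ (Q : Set (ℝ × EuclideanSpace ℝ (Fin 3))) :=
    (parabolicCylinder_mono hr₂0.le hr₂r₀ z).trans hQ
  have hD₂ : cknD r₂ z p ≠ ∞ := by
    refine ne_top_of_le_ne_top (ENNReal.mul_ne_top (ENNReal.pow_ne_top ENNReal.ofReal_ne_top)
      hD₀) (cknD_le_mul_of_subset hr₀ hr₂0 (parabolicCylinder_mono hr₂0.le hr₂r₀ z) p)
  have hM₂ : ∀ r ∈ Ioc (0 : ℝ) r₂, cknC r z u ≤ M := fun r hr => hM r ⟨hr.1, hr.2.trans hr₂ρ⟩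
  obtain ⟨K, hK⟩ := scaledEnergies_bounded_of_cknC_le hsw hG hr₂0 hQ₂ hD₂ hM₂
  exact ⟨K, r₂ / 2, half_pos hr₂0, hK⟩

end Seregin2020

end Literature.Analysis.FluidPDE
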